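import Literature.NumberTheory.Sieve.FriedlanderIwaniecPrimesDispersion
import Mathlib.Analysis.MellinTransform
import Mathlib.Analysis.MellinInversion
import HarnessLib

/-!
# Friedlander–Iwaniec, *The polynomial `X² + Y⁴` captures its primes*, §16 (16.28): the Mellin transform of the radius mollifier `p(n)`

[FI, §16, p. 63 of arXiv:math/9811185], right after (16.27):

> "Next we write the "radius mollifier" `p(n)` as the Mellin transform
> `p(n) = (1/2πi) ∫_{(σ)} p̂(s) n^{-s} ds` where `1/2 ≤ σ ≤ 2`. Since `p(n)` is supported on the
> segment (4.12) and its derivatives satisfy (4.14) it follows that `p̂(s)` is entire and bounded by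
> (16.28) `p̂(s) ≪ θ (1 + θ²t²)⁻¹ N^σ`."

Here (4.12) is the segment `N' < n ≤ (1 + θ)N'` (`N < N' < 2N`) and (4.14) is `p^{(j)} ≪ (θN)^{-j}`,
`j = 0, 1, 2`; in the tree these are the fields of `FICutoff θ N N' p`
(`FriedlanderIwaniecPrimesDispersion`, normalised: `|p| ≤ 1`, `|p'| ≤ (θN)⁻¹`, `|p''| ≤ (θN)⁻²`),
and `p̂ = mellin (fun t ↦ (p t : ℂ))` is Mathlib's Mellin transform
`p̂(s) = ∫_0^∞ t^{s-1} p(t) dt`. We prove, for `FICutoff θ N N' p` with `0 < θ ≤ 1`,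
`0 < N < N' < 2N`:

* `FICutoff.differentiable_mellin` — "`p̂(s)` is entire"; `FICutoff.mellinConvergent` — the
  Mellin integral converges absolutely for every `s`;
* `FICutoff.norm_mellin_le` — **(16.28) with an explicit constant**:
  `‖p̂(s)‖ ≤ 256 θ N^σ (1 + θ²t²)⁻¹` for `s = σ + it`, `-1 ≤ σ ≤ 2` (so in particular on the
  printed range `1/2 ≤ σ ≤ 2`). The proof is the one the text alludes to: trivially
  `‖p̂(s)‖ ≤ 8θN^σ` from the support (of length `θN' ≤ 2θN`, on which `t^{σ-1} ≤ 4N^{σ-1}`), and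
  after two integrations by parts against `t^s/s` and `t^{s+1}/(s+1)` (the boundary terms vanish
  because `p = p' = 0` at `N` and `4N`), `p̂(s) = (s(s+1))⁻¹ ∫ t^{s+1} p''(t) dt`, whence
  `‖p̂(s)‖ ≤ 128 θ⁻¹ N^σ t⁻²` (`|p''| ≤ (θN)⁻²`, `t^{σ+1} ≤ 64N^{σ+1}` on `[N, 4N]`,
  `|s(s+1)| ≥ t²`); the two bounds combine to `min(θ, θ⁻¹t⁻²) ≤ 2θ(1 + θ²t²)⁻¹`.
* `FICutoff.verticalIntegrable_mellin`, `FICutoff.mellin_inversion`, `FICutoff.eq_mellin_integral`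
  — the inversion formula `p(x) = (1/2πi) ∫_{(σ)} p̂(s) x^{-s} ds` (Mathlib's `mellinInv_mellin_eq`,
  whose hypotheses are exactly the convergence and the vertical integrability supplied by (16.28)).

No new definitions and no named facts; a pattern for the Mellin side is
`TwistedWeightMellinInversion` (same topic).
-/

noncomputable section

open Real Complex MeasureTheory Set Filter Asymptotics
open scoped Topology

namespace Literature.NumberTheory.Sieve.FriedlanderIwaniecPrimes

/-! ### Elementary helpers -/

/-- `t^e ≤ 4N^e` for `N ≤ t ≤ 4N` and `e ≤ 1`. [folklore] -/
private theorem rpow_le_four_mul_rpow {N t e : ℝ} (hN : 0 < N) (h1 : N ≤ t) (h2 : t ≤ 4 * N)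
    (he : e ≤ 1) : t ^ e ≤ 4 * N ^ e := by
  have ht : 0 < t := hN.trans_le h1
  have hNe : 0 < N ^ e := Real.rpow_pos_of_pos hN e
  rcases le_or_gt 0 e with he0 | he0
  · calc t ^ e ≤ (4 * N) ^ e := Real.rpow_le_rpow ht.le h2 he0
      _ = 4 ^ e * N ^ e := Real.mul_rpow (by norm_num) hN.le
      _ ≤ (4 : ℝ) ^ (1 : ℝ) * N ^ e :=
          mul_le_mul_of_nonneg_right (Real.rpow_le_rpow_of_exponent_le (by norm_num) he) hNe.le
      _ = 4 * N ^ e := by rw [Real.rpow_one]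
  · calc t ^ e ≤ N ^ e := Real.rpow_le_rpow_of_nonpos hN h1 he0.le
      _ ≤ 4 * N ^ e := by linarith

/-- `t^e ≤ 64N^e` for `N ≤ t ≤ 4N` and `0 ≤ e ≤ 3`. [folklore] -/
private theorem rpow_le_sixtyfour_mul_rpow {N t e : ℝ} (hN : 0 < N) (h1 : N ≤ t) (h2 : t ≤ 4 * N)
    (he0 : 0 ≤ e) (he : e ≤ 3) : t ^ e ≤ 64 * N ^ e := by
  have ht : 0 < t := hN.trans_le h1
  have hNe : 0 < N ^ e := Real.rpow_pos_of_pos hN e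
  calc t ^ e ≤ (4 * N) ^ e := Real.rpow_le_rpow ht.le h2 he0
    _ = 4 ^ e * N ^ e := Real.mul_rpow (by norm_num) hN.le
    _ ≤ (4 : ℝ) ^ (3 : ℝ) * N ^ e :=
        mul_le_mul_of_nonneg_right (Real.rpow_le_rpow_of_exponent_le (by norm_num) he) hNe.le
    _ = 64 * N ^ e := by
        rw [show (3 : ℝ) = (3 : ℕ) by norm_num, Real.rpow_natCast]; norm_num

/-- A function vanishing on an open interval has vanishing derivative there. [folklore] -/
private theorem deriv_eq_zero_of_forall_Ioo {f : ℝ → ℝ} {a b x : ℝ}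
    (hf : ∀ y, a < y → y < b → f y = 0) (h1 : a < x) (h2 : x < b) : deriv f x = 0 := by
  have h : f =ᶠ[𝓝 x] fun _ => (0 : ℝ) :=
    Filter.eventuallyEq_of_mem (Ioo_mem_nhds h1 h2) fun y hy => hf y hy.1 hy.2
  rw [h.deriv_eq, deriv_const]

/-- `min(Kθ, Kθ⁻¹t⁻²) ≤ 2Kθ(1 + θ²t²)⁻¹`. [folklore] -/
private theorem le_two_mul_div_one_add {θ x t K : ℝ} (hθ : 0 < θ) (hK : 0 ≤ K) (h0 : x ≤ K * θ)
    (ht : t ≠ 0 → x ≤ K * θ⁻¹ / t ^ 2) : x ≤ 2 * K * θ / (1 + θ ^ 2 * t ^ 2) := by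
  rw [le_div_iff₀ (by positivity)]
  rcases eq_or_ne t 0 with rfl | ht0
  · nlinarith
  · have ht2 : (0 : ℝ) < t ^ 2 := by rw [← sq_abs]; exact pow_pos (abs_pos.mpr ht0) 2
    have h1 : x * t ^ 2 ≤ K * θ⁻¹ := (le_div_iff₀ ht2).mp (ht ht0)
    have h2 : x * t ^ 2 * θ ≤ K := by
      have := mul_le_mul_of_nonneg_right h1 hθ.le
      rwa [mul_assoc K, inv_mul_cancel₀ hθ.ne', mul_one] at this
    nlinarith [mul_le_mul_of_nonneg_right h2 hθ.le]

/-! ### The cutoff: support and regime -/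

section Cutoff

variable {θ N N' : ℝ} {p : ℝ → ℝ}

/-- `p = 0` on `(-∞, N']`. [folklore] -/
private theorem cutoff_eq_zero_of_le (h : FICutoff θ N N' p) {u : ℝ} (hu : u ≤ N') : p u = 0 := by
  by_contra hne
  exact absurd (h.supp u hne).1 (not_lt.mpr hu)

/-- `p = 0` on `((1 + θ)N', ∞)`. [folklore] -/
private theorem cutoff_eq_zero_of_gt (h : FICutoff θ N N' p) {u : ℝ} (hu : (1 + θ) * N' < u) :
    p u = 0 := by
  by_contra hne
  exact absurd (h.supp u hne).2 (not_le.mpr hu)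

/-- `p' = 0` left of `N'`. [folklore] -/
private theorem cutoff_deriv_eq_zero_of_lt (h : FICutoff θ N N' p) {u : ℝ} (hu : u < N') :
    deriv p u = 0 :=
  deriv_eq_zero_of_forall_Ioo (a := u - 1) (b := N') (fun _ _ hy => cutoff_eq_zero_of_le h hy.le)
    (by linarith) hu

/-- `p' = 0` right of `(1 + θ)N'`. [folklore] -/
private theorem cutoff_deriv_eq_zero_of_gt (h : FICutoff θ N N' p) {u : ℝ} (hu : (1 + θ) * N' < u) :
    deriv p u = 0 :=
  deriv_eq_zero_of_forall_Ioo (a := (1 + θ) * N') (b := u + 1) (fun _ hy _ => cutoff_eq_zero_of_gt h hy)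
    hu (by linarith)

/-- `p'' = 0` left of `N'`. [folklore] -/
private theorem cutoff_deriv2_eq_zero_of_lt (h : FICutoff θ N N' p) {u : ℝ} (hu : u < N') :
    deriv (deriv p) u = 0 :=
  deriv_eq_zero_of_forall_Ioo (f := deriv p) (a := u - 1) (b := N')
    (fun _ _ hy => cutoff_deriv_eq_zero_of_lt h hy) (by linarith) hu

/-- `p'' = 0` right of `(1 + θ)N'`. [folklore] -/
private theorem cutoff_deriv2_eq_zero_of_gt (h : FICutoff θ N N' p) {u : ℝ}
    (hu : (1 + θ) * N' < u) : deriv (deriv p) u = 0 :=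
  deriv_eq_zero_of_forall_Ioo (f := deriv p) (a := (1 + θ) * N') (b := u + 1)
    (fun _ hy _ => cutoff_deriv_eq_zero_of_gt h hy) hu (by linarith)

/-! ### `p̂` is entire -/

/-- `p = O(t^{-a})` at `+∞` (it vanishes there). [folklore] -/
private theorem cutoff_isBigO_atTop (h : FICutoff θ N N' p) (a : ℝ) :
    (fun t => (p t : ℂ)) =O[atTop] fun t : ℝ => t ^ (-a) := by
  have hev : (fun t => (p t : ℂ)) =ᶠ[atTop] fun _ => (0 : ℂ) := by
    filter_upwards [eventually_gt_atTop ((1 + θ) * N')] with t ht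
    rw [cutoff_eq_zero_of_gt h ht, Complex.ofReal_zero]
  exact (isBigO_zero _ _).congr' hev.symm EventuallyEq.rfl

/-- `p = O(t^{-b})` at `0⁺` (it vanishes there, `N' > 0`). [folklore] -/
private theorem cutoff_isBigO_nhds_zero (h : FICutoff θ N N' p) (hN' : 0 < N') (b : ℝ) :
    (fun t => (p t : ℂ)) =O[𝓝[>] 0] fun t : ℝ => t ^ (-b) := by
  have hev : (fun t => (p t : ℂ)) =ᶠ[𝓝[>] 0] fun _ => (0 : ℂ) := by
    filter_upwards [Ioo_mem_nhdsGT hN'] with t ht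
    rw [cutoff_eq_zero_of_le h ht.2.le, Complex.ofReal_zero]
  exact (isBigO_zero _ _).congr' hev.symm EventuallyEq.rfl

/-- `p` is locally integrable on `(0, ∞)`. [folklore] -/
private theorem cutoff_locallyIntegrableOn (h : FICutoff θ N N' p) :
    LocallyIntegrableOn (fun t => (p t : ℂ)) (Ioi 0) :=
  (continuous_ofReal.comp h.smooth.continuous).locallyIntegrable.locallyIntegrableOn _

/-- The Mellin integral `p̂(s) = ∫_0^∞ t^{s-1} p(t) dt` converges absolutely for **every** `s`
(`p` has compact support in `(0, ∞)`). [cite: FriedlanderIwaniecAnnals1998, §16 before (16.28)] -/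
theorem FICutoff.mellinConvergent (h : FICutoff θ N N' p) (hN' : 0 < N') (s : ℂ) :
    MellinConvergent (fun t => (p t : ℂ)) s :=
  mellinConvergent_of_isBigO_rpow (a := s.re + 1) (b := s.re - 1) (cutoff_locallyIntegrableOn h)
    (cutoff_isBigO_atTop h _) (by linarith) (cutoff_isBigO_nhds_zero h hN' _) (by linarith)

/-- **"`p̂(s)` is entire."** [cite: FriedlanderIwaniecAnnals1998, §16 before (16.28)] -/
theorem FICutoff.differentiable_mellin (h : FICutoff θ N N' p) (hN' : 0 < N') :
    Differentiable ℂ (mellin fun t => (p t : ℂ)) := fun s =>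
  mellin_differentiableAt_of_isBigO_rpow (a := s.re + 1) (b := s.re - 1) (cutoff_locallyIntegrableOn h)
    (cutoff_isBigO_atTop h _) (by linarith) (cutoff_isBigO_nhds_zero h hN' _) (by linarith)

/-! ### (16.28) -/

/-- The Mellin integral lives on `(N, 4N]`: `p̂(s) = ∫_N^{4N} t^{s-1} p(t) dt`. [folklore] -/
private theorem mellin_cutoff_eq (h : FICutoff θ N N' p) (hN : 0 < N) (hNN' : N < N')
    (h4 : (1 + θ) * N' < 4 * N) (s : ℂ) :
    mellin (fun t => (p t : ℂ)) s = ∫ t in N..(4 * N), (t : ℂ) ^ (s - 1) * (p t : ℂ) := by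
  have hzero : ∀ t ∈ Ioi (0 : ℝ) \ Ioc N (4 * N), (t : ℂ) ^ (s - 1) • ((p t : ℝ) : ℂ) = 0 := by
    rintro t ⟨-, ht⟩
    rw [mem_Ioc, not_and_or, not_lt, not_le] at ht
    rcases ht with ht | ht
    · rw [cutoff_eq_zero_of_le h (ht.trans hNN'.le), Complex.ofReal_zero, smul_zero]
    · rw [cutoff_eq_zero_of_gt h (h4.trans ht), Complex.ofReal_zero, smul_zero]
  rw [mellin, setIntegral_eq_of_subset_of_forall_sdiff_eq_zero measurableSet_Ioi
      (fun t ht => hN.trans ht.1) hzero, intervalIntegral.integral_of_le (by linarith)]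
  simp only [smul_eq_mul]

/-- **The support bound** `‖p̂(s)‖ ≤ 8θN^σ` (`σ ≤ 2`): the support `(N', (1+θ)N']` has length
`θN' ≤ 2θN` and `t^{σ-1} ≤ 4N^{σ-1}` on it. [cite: FriedlanderIwaniecAnnals1998, (16.28)] -/
theorem FICutoff.norm_mellin_le_support (h : FICutoff θ N N' p) (hθ : 0 < θ) (hθ1 : θ ≤ 1)
    (hN : 0 < N) (hNN' : N < N') (hN'2 : N' < 2 * N) {s : ℂ} (hs : s.re ≤ 2) :
    ‖mellin (fun t => (p t : ℂ)) s‖ ≤ 8 * θ * N ^ s.re := by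
  have hN'0 : 0 < N' := hN.trans hNN'
  have h4 : (1 + θ) * N' < 4 * N := by nlinarith
  rw [mellin_cutoff_eq h hN hNN' h4 s]
  set σ := s.re with hσ
  set g : ℝ → ℝ := (Ioc N' ((1 + θ) * N')).indicator fun _ => 4 * N ^ (σ - 1) with hg
  have hbound : ∀ᵐ t : ℝ, t ∈ Ioc N (4 * N) → ‖(t : ℂ) ^ (s - 1) * (p t : ℂ)‖ ≤ g t := by
    refine Eventually.of_forall fun t ht => ?_
    have ht0 : 0 < t := hN.trans ht.1
    rw [norm_mul, Complex.norm_cpow_eq_rpow_re_of_pos ht0, Complex.sub_re, Complex.one_re,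
      Complex.norm_real, Real.norm_eq_abs, hg]
    by_cases hmem : t ∈ Ioc N' ((1 + θ) * N')
    · rw [indicator_of_mem hmem]
      calc t ^ (σ - 1) * |p t| ≤ 4 * N ^ (σ - 1) * 1 :=
            mul_le_mul (rpow_le_four_mul_rpow hN ht.1.le ht.2 (by linarith)) (h.bound t)
              (abs_nonneg _) (by positivity)
        _ = 4 * N ^ (σ - 1) := mul_one _
    · rw [indicator_of_notMem hmem]
      rw [mem_Ioc, not_and_or, not_lt, not_le] at hmem
      rcases hmem with h1 | h1
      · rw [cutoff_eq_zero_of_le h h1, abs_zero, mul_zero]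
      · rw [cutoff_eq_zero_of_gt h h1, abs_zero, mul_zero]
  have hgi : IntervalIntegrable g volume N (4 * N) := by
    refine (intervalIntegrable_const (c := 4 * N ^ (σ - 1))).mono_fun'
      (aestronglyMeasurable_const.indicator measurableSet_Ioc) (Eventually.of_forall fun t => ?_)
    dsimp only
    rw [hg, Real.norm_eq_abs, abs_of_nonneg (indicator_nonneg (fun _ _ => by positivity) _)]
    exact indicator_le_self' (fun _ _ => by positivity) t
  have hint := intervalIntegral.norm_integral_le_of_norm_le (by linarith : N ≤ 4 * N) hbound hgi
  have hsub : Ioc N' ((1 + θ) * N') ⊆ Ioc N (4 * N) := Ioc_subset_Ioc hNN'.le h4.le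
  have hgint : ∫ t in N..(4 * N), g t = 4 * N ^ (σ - 1) * (θ * N') := by
    rw [intervalIntegral.integral_of_le (by linarith), hg, setIntegral_indicator measurableSet_Ioc,
      inter_eq_self_of_subset_right hsub, setIntegral_const, Real.volume_real_Ioc_of_le (by nlinarith),
      smul_eq_mul]
    ring
  rw [hgint] at hint
  refine hint.trans ?_
  rw [Real.rpow_sub_one hN.ne']
  have key : N ^ σ / N * N' ≤ 2 * N ^ σ := by
    rw [div_mul_eq_mul_div, div_le_iff₀ hN]; nlinarith [Real.rpow_pos_of_pos hN σ]
  have := mul_le_mul_of_nonneg_left key (by positivity : (0 : ℝ) ≤ 4 * θ)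
  linarith

/-- **Two integrations by parts**: for `s ≠ 0, -1`,
`p̂(s) = (s(s+1))⁻¹ ∫_N^{4N} t^{s+1} p''(t) dt` (the boundary terms vanish since `p = p' = 0` at
`N` and `4N`). [cite: FriedlanderIwaniecAnnals1998, (16.28)] -/
theorem FICutoff.mellin_eq_integral_deriv2 (h : FICutoff θ N N' p) (hθ1 : θ ≤ 1) (hN : 0 < N)
    (hNN' : N < N') (hN'2 : N' < 2 * N) {s : ℂ} (hs0 : s ≠ 0) (hs1 : s ≠ -1) :
    mellin (fun t => (p t : ℂ)) s =
      1 / (s * (s + 1)) * ∫ t in N..(4 * N), (t : ℂ) ^ (s + 1) * ((deriv (deriv p) t : ℝ) : ℂ) := by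
  have hN'0 : 0 < N' := hN.trans hNN'
  have h4 : (1 + θ) * N' < 4 * N := by nlinarith
  rw [mellin_cutoff_eq h hN hNN' h4 s]
  -- derivative data
  have h1c : ContDiff ℝ 1 (deriv p) := h.smooth.deriv'
  have hd₀ : ∀ x, HasDerivAt p (deriv p x) x := fun x =>
    ((h.smooth.differentiable (by norm_num)) x).hasDerivAt
  have hd₁ : ∀ x, HasDerivAt (deriv p) (deriv (deriv p) x) x := fun x =>
    ((h1c.differentiable (by norm_num)) x).hasDerivAt
  have h2c' : ContDiff ℝ 0 (deriv (deriv p)) := h1c.deriv'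
  have h2c : Continuous (deriv (deriv p)) := h2c'.continuous
  have hD₀ : ∀ x, HasDerivAt (fun t => (p t : ℂ)) ((deriv p x : ℝ) : ℂ) x := fun x =>
    (hd₀ x).ofReal_comp
  have hD₁ : ∀ x, HasDerivAt (fun t => ((deriv p t : ℝ) : ℂ)) ((deriv (deriv p) x : ℝ) : ℂ) x := fun x =>
    (hd₁ x).ofReal_comp
  have hPc : Continuous fun t => (p t : ℂ) := continuous_ofReal.comp h.smooth.continuous
  have hP₁c : Continuous fun t => ((deriv p t : ℝ) : ℂ) := continuous_ofReal.comp h1c.continuous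
  have hP₂c : Continuous fun t => ((deriv (deriv p) t : ℝ) : ℂ) := continuous_ofReal.comp h2c
  -- boundary values
  have hPN : (p N : ℂ) = 0 := by rw [cutoff_eq_zero_of_le h hNN'.le, Complex.ofReal_zero]
  have hP4N : (p (4 * N) : ℂ) = 0 := by rw [cutoff_eq_zero_of_gt h h4, Complex.ofReal_zero]
  have hP₁N : ((deriv p N : ℝ) : ℂ) = 0 := by
    rw [cutoff_deriv_eq_zero_of_lt h hNN', Complex.ofReal_zero]
  have hP₁4N : ((deriv p (4 * N) : ℝ) : ℂ) = 0 := by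
    rw [cutoff_deriv_eq_zero_of_gt h h4, Complex.ofReal_zero]
  -- the primitives `t^s/s`, `t^(s+1)/(s+1)` and their derivatives on `(N, 4N)`
  have hIoo : ∀ t ∈ Ioo (min N (4 * N)) (max N (4 * N)), t ≠ 0 := by
    intro t ht
    rw [min_eq_left (by linarith), max_eq_right (by linarith)] at ht
    exact (hN.trans ht.1).ne'
  have hv : ∀ t ∈ Ioo (min N (4 * N)) (max N (4 * N)),
      HasDerivAt (fun y : ℝ => (y : ℂ) ^ s / s) ((t : ℂ) ^ (s - 1)) t := by
    intro t ht
    have := hasDerivAt_ofReal_cpow_const' (hIoo t ht) (r := s - 1)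
      (by intro h0; apply hs0; linear_combination h0)
    simp only [sub_add_cancel] at this
    exact this
  have hw : ∀ t ∈ Ioo (min N (4 * N)) (max N (4 * N)),
      HasDerivAt (fun y : ℝ => (y : ℂ) ^ (s + 1) / (s + 1)) ((t : ℂ) ^ s) t := fun t ht =>
    hasDerivAt_ofReal_cpow_const' (hIoo t ht) (r := s) (by intro h0; apply hs1; linear_combination h0)
  have hcpow : ∀ z c : ℂ, ContinuousOn (fun y : ℝ => (y : ℂ) ^ z / c) (uIcc N (4 * N)) := by
    intro z c t ht
    rw [uIcc_of_le (by linarith)] at ht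
    exact ((continuousAt_ofReal_cpow_const t z (Or.inr (hN.trans_le ht.1).ne')).div_const c)
      |>.continuousWithinAt
  have hcpow' : ∀ z : ℂ, ContinuousOn (fun y : ℝ => (y : ℂ) ^ z) (uIcc N (4 * N)) := by
    intro z t ht
    rw [uIcc_of_le (by linarith)] at ht
    exact (continuousAt_ofReal_cpow_const t z (Or.inr (hN.trans_le ht.1).ne')).continuousWithinAt
  -- first integration by parts
  have ibp1 := intervalIntegral.integral_mul_deriv_eq_deriv_mul_of_hasDerivAt (a := N) (b := 4 * N)
    (u := fun t => (p t : ℂ)) (v := fun y : ℝ => (y : ℂ) ^ s / s) (u' := fun t => ((deriv p t : ℝ) : ℂ))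
    (v' := fun y : ℝ => (y : ℂ) ^ (s - 1)) hPc.continuousOn (hcpow s s) (fun x _ => hD₀ x) hv
    (hP₁c.intervalIntegrable _ _) (hcpow' (s - 1)).intervalIntegrable
  rw [hPN, hP4N, zero_mul, zero_mul, sub_zero, zero_sub] at ibp1
  -- second integration by parts
  have ibp2 := intervalIntegral.integral_mul_deriv_eq_deriv_mul_of_hasDerivAt (a := N) (b := 4 * N)
    (u := fun t => ((deriv p t : ℝ) : ℂ)) (v := fun y : ℝ => (y : ℂ) ^ (s + 1) / (s + 1))
    (u' := fun t => ((deriv (deriv p) t : ℝ) : ℂ)) (v' := fun y : ℝ => (y : ℂ) ^ s) hP₁c.continuousOn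
    (hcpow (s + 1) (s + 1)) (fun x _ => hD₁ x) hw (hP₂c.intervalIntegrable _ _)
    (hcpow' s).intervalIntegrable
  rw [hP₁N, hP₁4N, zero_mul, zero_mul, sub_zero, zero_sub] at ibp2
  -- assemble
  calc ∫ t in N..(4 * N), (t : ℂ) ^ (s - 1) * (p t : ℂ)
      = ∫ t in N..(4 * N), (p t : ℂ) * (t : ℂ) ^ (s - 1) := by
        refine intervalIntegral.integral_congr fun t _ => ?_
        exact mul_comm _ _
    _ = -∫ t in N..(4 * N), ((deriv p t : ℝ) : ℂ) * ((t : ℂ) ^ s / s) := ibp1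
    _ = -(1 / s) * ∫ t in N..(4 * N), ((deriv p t : ℝ) : ℂ) * (t : ℂ) ^ s := by
        rw [neg_mul, ← intervalIntegral.integral_const_mul]
        congr 1
        refine intervalIntegral.integral_congr fun t _ => ?_
        show ((deriv p t : ℝ) : ℂ) * ((t : ℂ) ^ s / s) = 1 / s * (((deriv p t : ℝ) : ℂ) * (t : ℂ) ^ s)
        field_simp
    _ = -(1 / s) * -∫ t in N..(4 * N), ((deriv (deriv p) t : ℝ) : ℂ) * ((t : ℂ) ^ (s + 1) / (s + 1)) := by
        rw [ibp2]
    _ = 1 / (s * (s + 1)) * ∫ t in N..(4 * N), (t : ℂ) ^ (s + 1) * ((deriv (deriv p) t : ℝ) : ℂ) := by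
        rw [mul_neg, neg_mul, neg_neg, ← intervalIntegral.integral_const_mul,
          ← intervalIntegral.integral_const_mul]
        refine intervalIntegral.integral_congr fun t _ => ?_
        show 1 / s * (((deriv (deriv p) t : ℝ) : ℂ) * ((t : ℂ) ^ (s + 1) / (s + 1))) =
          1 / (s * (s + 1)) * ((t : ℂ) ^ (s + 1) * ((deriv (deriv p) t : ℝ) : ℂ))
        have hs1' : s + 1 ≠ 0 := by intro h0; apply hs1; linear_combination h0
        field_simp

/-- **The bound after two integrations by parts**: `‖∫_N^{4N} t^{s+1} p''(t) dt‖ ≤ 128 θ⁻¹ N^σ`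
for `-1 ≤ σ ≤ 2` (`|p''| ≤ (θN)⁻²`, `t^{σ+1} ≤ 64N^{σ+1}`, support of length `θN' ≤ 2θN`).
[cite: FriedlanderIwaniecAnnals1998, (16.28)] -/
theorem FICutoff.norm_integral_deriv2_le (h : FICutoff θ N N' p) (hθ : 0 < θ) (hθ1 : θ ≤ 1)
    (hN : 0 < N) (hNN' : N < N') (hN'2 : N' < 2 * N) {s : ℂ} (hs1 : -1 ≤ s.re) (hs2 : s.re ≤ 2) :
    ‖∫ t in N..(4 * N), (t : ℂ) ^ (s + 1) * ((deriv (deriv p) t : ℝ) : ℂ)‖ ≤ 128 * θ⁻¹ * N ^ s.re := by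
  have hN'0 : 0 < N' := hN.trans hNN'
  have h4 : (1 + θ) * N' < 4 * N := by nlinarith
  have hθN : 0 < θ * N := mul_pos hθ hN
  set σ := s.re with hσ
  set C : ℝ := (θ * N)⁻¹ ^ 2 * (64 * N ^ (σ + 1)) with hC
  have hC0 : 0 ≤ C := by positivity
  set g : ℝ → ℝ := (Icc N' ((1 + θ) * N')).indicator fun _ => C with hg
  have hbound : ∀ᵐ t : ℝ, t ∈ Ioc N (4 * N) →
      ‖(t : ℂ) ^ (s + 1) * ((deriv (deriv p) t : ℝ) : ℂ)‖ ≤ g t := by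
    refine Eventually.of_forall fun t ht => ?_
    have ht0 : 0 < t := hN.trans ht.1
    rw [norm_mul, Complex.norm_cpow_eq_rpow_re_of_pos ht0, Complex.add_re, Complex.one_re,
      Complex.norm_real, Real.norm_eq_abs, hg]
    by_cases hmem : t ∈ Icc N' ((1 + θ) * N')
    · rw [indicator_of_mem hmem, hC]
      have h64 : t ^ (σ + 1) ≤ 64 * N ^ (σ + 1) :=
        rpow_le_sixtyfour_mul_rpow hN ht.1.le ht.2 (by linarith) (by linarith)
      calc t ^ (σ + 1) * |deriv (deriv p) t| ≤ 64 * N ^ (σ + 1) * (θ * N)⁻¹ ^ 2 :=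
            mul_le_mul h64 (h.deriv2_bound t) (abs_nonneg _) (by positivity)
        _ = (θ * N)⁻¹ ^ 2 * (64 * N ^ (σ + 1)) := mul_comm _ _
    · rw [indicator_of_notMem hmem]
      rw [mem_Icc, not_and_or, not_le, not_le] at hmem
      rcases hmem with h1 | h1
      · rw [cutoff_deriv2_eq_zero_of_lt h h1, abs_zero, mul_zero]
      · rw [cutoff_deriv2_eq_zero_of_gt h h1, abs_zero, mul_zero]
  have hgi : IntervalIntegrable g volume N (4 * N) := by
    refine (intervalIntegrable_const (c := C)).mono_fun'
      (aestronglyMeasurable_const.indicator measurableSet_Icc) (Eventually.of_forall fun t => ?_)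
    dsimp only
    rw [hg, Real.norm_eq_abs, abs_of_nonneg (indicator_nonneg (fun _ _ => hC0) _)]
    exact indicator_le_self' (fun _ _ => hC0) t
  have hint := intervalIntegral.norm_integral_le_of_norm_le (by linarith : N ≤ 4 * N) hbound hgi
  have hsub : Icc N' ((1 + θ) * N') ⊆ Ioc N (4 * N) := fun t ht =>
    ⟨hNN'.trans_le ht.1, ht.2.trans h4.le⟩
  have hgint : ∫ t in N..(4 * N), g t = C * (θ * N') := by
    rw [intervalIntegral.integral_of_le (by linarith), hg, setIntegral_indicator measurableSet_Icc,
      inter_eq_self_of_subset_right hsub, setIntegral_const, Real.volume_real_Icc_of_le (by nlinarith),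
      smul_eq_mul]
    ring
  rw [hgint] at hint
  refine hint.trans ?_
  rw [hC, Real.rpow_add_one hN.ne']
  have e1 : (θ * N)⁻¹ ^ 2 * (64 * (N ^ σ * N)) * (θ * N') = 64 * N ^ σ * ((θ * N)⁻¹ * N') := by
    have hc : (θ * N)⁻¹ * (θ * N) = 1 := inv_mul_cancel₀ hθN.ne'
    calc (θ * N)⁻¹ ^ 2 * (64 * (N ^ σ * N)) * (θ * N')
        = 64 * N ^ σ * ((θ * N)⁻¹ * N') * ((θ * N)⁻¹ * (θ * N)) := by ring
      _ = 64 * N ^ σ * ((θ * N)⁻¹ * N') := by rw [hc, mul_one]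
  have e2 : (θ * N)⁻¹ * N' ≤ 2 * θ⁻¹ := by
    rw [mul_inv, mul_assoc]
    have hq : N⁻¹ * N' ≤ 2 := by rw [inv_mul_le_iff₀ hN]; linarith
    nlinarith [inv_pos.mpr hθ]
  rw [e1]
  have := mul_le_mul_of_nonneg_left e2 (by positivity : (0 : ℝ) ≤ 64 * N ^ σ)
  linarith

/-- **(16.28).** For the radius mollifier `p` of (4.12)–(4.14) (`FICutoff θ N N' p`, `0 < θ ≤ 1`,
`0 < N < N' < 2N`) and `s = σ + it` with `-1 ≤ σ ≤ 2` (in particular for the printed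
`1/2 ≤ σ ≤ 2`): `‖p̂(s)‖ ≤ 256 θ N^σ (1 + θ²t²)⁻¹` — the printed `p̂(s) ≪ θ(1 + θ²t²)⁻¹N^σ` with
the constant `256`. [cite: FriedlanderIwaniecAnnals1998, (16.28)] -/
theorem FICutoff.norm_mellin_le (h : FICutoff θ N N' p) (hθ : 0 < θ) (hθ1 : θ ≤ 1) (hN : 0 < N)
    (hNN' : N < N') (hN'2 : N' < 2 * N) {s : ℂ} (hs1 : -1 ≤ s.re) (hs2 : s.re ≤ 2) :
    ‖mellin (fun t => (p t : ℂ)) s‖ ≤ 256 * θ * N ^ s.re / (1 + θ ^ 2 * s.im ^ 2) := by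
  have hK : 0 ≤ 128 * N ^ s.re := by positivity
  have hb0 : ‖mellin (fun t => (p t : ℂ)) s‖ ≤ 128 * N ^ s.re * θ := by
    have := h.norm_mellin_le_support hθ hθ1 hN hNN' hN'2 hs2
    nlinarith [Real.rpow_pos_of_pos hN s.re]
  have hbt : s.im ≠ 0 → ‖mellin (fun t => (p t : ℂ)) s‖ ≤ 128 * N ^ s.re * θ⁻¹ / s.im ^ 2 := by
    intro ht
    have hs0 : s ≠ 0 := fun h0 => ht (by rw [h0]; simp)
    have hs1' : s ≠ -1 := fun h0 => ht (by rw [h0]; simp)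
    rw [h.mellin_eq_integral_deriv2 hθ1 hN hNN' hN'2 hs0 hs1', norm_mul]
    have hI := h.norm_integral_deriv2_le hθ hθ1 hN hNN' hN'2 hs1 hs2
    have hst : s.im ^ 2 ≤ ‖s * (s + 1)‖ := by
      rw [norm_mul]
      have h1 : |s.im| ≤ ‖s‖ := Complex.abs_im_le_norm s
      have h2 : |s.im| ≤ ‖s + 1‖ := by
        have := Complex.abs_im_le_norm (s + 1)
        simpa using this
      calc s.im ^ 2 = |s.im| * |s.im| := by rw [← sq, sq_abs]
        _ ≤ ‖s‖ * ‖s + 1‖ := mul_le_mul h1 h2 (abs_nonneg _) (norm_nonneg _)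
    have ht2 : (0 : ℝ) < s.im ^ 2 := by rw [← sq_abs]; exact pow_pos (abs_pos.mpr ht) 2
    have hn : ‖1 / (s * (s + 1))‖ ≤ 1 / s.im ^ 2 := by
      rw [norm_div, norm_one]
      exact one_div_le_one_div_of_le ht2 hst
    refine (mul_le_mul hn hI (norm_nonneg _) (by positivity)).trans_eq ?_
    ring
  calc ‖mellin (fun t => (p t : ℂ)) s‖
      ≤ 2 * (128 * N ^ s.re) * θ / (1 + θ ^ 2 * s.im ^ 2) := le_two_mul_div_one_add hθ hK hb0 hbt
    _ = 256 * θ * N ^ s.re / (1 + θ ^ 2 * s.im ^ 2) := by ring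

/-! ### Mellin inversion for `p` -/

/-- `p̂` is integrable along every vertical line `Re s = σ`, `-1 ≤ σ ≤ 2` (from (16.28)).
[cite: FriedlanderIwaniecAnnals1998, §16 before (16.28)] -/
theorem FICutoff.verticalIntegrable_mellin (h : FICutoff θ N N' p) (hθ : 0 < θ) (hθ1 : θ ≤ 1)
    (hN : 0 < N) (hNN' : N < N') (hN'2 : N' < 2 * N) {σ : ℝ} (hσ1 : -1 ≤ σ) (hσ2 : σ ≤ 2) :
    Complex.VerticalIntegrable (mellin fun t => (p t : ℂ)) σ := by
  rw [Complex.VerticalIntegrable]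
  have hcont : Continuous fun y : ℝ => mellin (fun t => (p t : ℂ)) (σ + y * I) :=
    (h.differentiable_mellin (hN.trans hNN')).continuous.comp (by fun_prop)
  refine Integrable.mono' (g := fun y : ℝ => 256 * θ * N ^ σ * (1 + (θ * y) ^ 2)⁻¹)
    ((integrable_inv_one_add_sq.comp_mul_left' hθ.ne').const_mul _) hcont.aestronglyMeasurable
    (Eventually.of_forall fun y => ?_)
  have hre : ((σ : ℂ) + y * I).re = σ := by simp
  have him : ((σ : ℂ) + y * I).im = y := by simp
  have := h.norm_mellin_le hθ hθ1 hN hNN' hN'2 (s := σ + y * I) (by rw [hre]; exact hσ1)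
    (by rw [hre]; exact hσ2)
  rw [hre, him] at this
  rw [mul_pow, ← div_eq_mul_inv]
  exact this

/-- **Mellin inversion for the radius mollifier**: `p(x) = (1/2πi) ∫_{(σ)} p̂(s) x^{-s} ds` for
`x > 0` and `-1 ≤ σ ≤ 2` (Mathlib's `mellinInv`; printed for `1/2 ≤ σ ≤ 2`).
[cite: FriedlanderIwaniecAnnals1998, §16 before (16.28)] -/
theorem FICutoff.mellin_inversion (h : FICutoff θ N N' p) (hθ : 0 < θ) (hθ1 : θ ≤ 1) (hN : 0 < N)
    (hNN' : N < N') (hN'2 : N' < 2 * N) {σ : ℝ} (hσ1 : -1 ≤ σ) (hσ2 : σ ≤ 2) {x : ℝ} (hx : 0 < x) :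
    mellinInv σ (mellin fun t => (p t : ℂ)) x = (p x : ℂ) :=
  mellinInv_mellin_eq σ _ hx (h.mellinConvergent (hN.trans hNN') σ)
    (h.verticalIntegrable_mellin hθ hθ1 hN hNN' hN'2 hσ1 hσ2)
    (continuous_ofReal.comp h.smooth.continuous).continuousAt

/-- The same, written out: `p(x) = (2π)⁻¹ ∫ x^{-(σ+it)} p̂(σ+it) dt` (`= (1/2πi) ∫_{(σ)} p̂(s) x^{-s} ds`).
[cite: FriedlanderIwaniecAnnals1998, §16 before (16.28)] -/
theorem FICutoff.eq_mellin_integral (h : FICutoff θ N N' p) (hθ : 0 < θ) (hθ1 : θ ≤ 1) (hN : 0 < N)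
    (hNN' : N < N') (hN'2 : N' < 2 * N) {σ : ℝ} (hσ1 : -1 ≤ σ) (hσ2 : σ ≤ 2) {x : ℝ} (hx : 0 < x) :
    (p x : ℂ) = (1 / (2 * π)) • ∫ y : ℝ, (x : ℂ) ^ (-((σ : ℂ) + y * I)) •
      mellin (fun t => (p t : ℂ)) (σ + y * I) := by
  rw [← h.mellin_inversion hθ hθ1 hN hNN' hN'2 hσ1 hσ2 hx, mellinInv]

end Cutoff

end Literature.NumberTheory.Sieve.FriedlanderIwaniecPrimes
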